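import Mathlib
import Literature.Computability.AlgebraicComplexity.NarayananElusiveProofs
import Summits.ValiantsHypothesis.ValiantsHypothesis.Theorems.BarrierLeverPartitionMinorsHitByVPBallUniversal

/-!
# Route BarrierLever — item `PartitionMinorsHitByVP` (stmt-ValiantsHypothesis-19717):
# Hamming-ball universality, the base case `e = 1` (a Vandermonde)

Helper file (`--supports stmt-ValiantsHypothesis-19717`; cell valiant-natproofs, rung V4, 𝒟-side, prover
seat val-np-p6 gen 4). Definition-free. Closes NO item.

Conjecture T1(h, e) of `…BallUniversal` (p528472): if the rows run through every subset of `Fin h` of size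
`≤ e` exactly once, then for EVERY injective column family some additive table is nonsingular. This file
proves the base case `e = 1` (rows `∅` and the `h` singletons, `r = h + 1`, ANY `h + 1` distinct columns):
with the table `ω₀ ≡ 1`, `ω a c = 2^{(a+1)·2^c} − 1` the additive matrix is `[x_j^{e_i}]` with
`x_j = 2^{bin(w j)}` (`bin(W) = Σ_{c∈W} 2^c`, injective) and `e_i = Σ_{a ∈ u i} (a+1) ∈ {0, …, h}` a
bijection onto `Fin (h+1)` — a transposed, reindexed VANDERMONDE matrix with distinct nodes.

* binary uniqueness `W ↦ Σ_{c∈W} 2^c` injective = `Literature.….doublingExp_injective` (Narayanan port), reused.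
* **`ballRowsUniversal_one`** — T1(h, 1): the hypothesis `hyp` of
  `partitionMinor_hit_ballRows_of_universal` / `…ballColumns_of_universal` for `e = 1`.
* **`partitionMinor_hit_ballRows_one`**, **`partitionMinor_hit_ballColumns_one`** — the two (polynomial-size,
  `r = h + 1`) classes, unconditionally: rows `{∅} ∪ singletons` × ANY `h+1` columns, and ANY `h+1` rows ×
  columns `{∅} ∪ singletons` — the latter contains the transposes of the CAPACITY layouts that kill every
  universal one-table template (BARRIER-capacity.md); here a layout-dependent additive table suffices.

WHAT THIS IS NOT: `r = h + 1` layouts are also hit by sparse witnesses; the point is the first rung of T1.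
Nothing on crux 14610 or VP vs VNP.
-/

set_option linter.dupNamespace false

namespace Summit.ValiantsHypothesis.ValiantsHypothesis.Theorems.BarrierLever.AdditiveDoor

open Finset
open Literature.Barriers.ValiantsHypothesis

noncomputable section

/-- **T1(h, 1): the ball of radius one is a universal row family.** If the rows are exactly `∅` and the
`h` singletons (in any order), then for every injective column family some additive table is nonsingular. -/
theorem ballRowsUniversal_one (h : ℕ) (r : ℕ) (u w : Fin r → Finset (Fin h))
    (hu : Function.Injective u) (hw : Function.Injective w)
    (hsmall : ∀ i, (u i).card ≤ 1) (hall : ∀ S : Finset (Fin h), S.card ≤ 1 → ∃ i, u i = S) :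
    ∃ (ω₀ : Fin h → ℂ) (ω : Fin h → Fin h → ℂ),
      (Matrix.of fun i j : Fin r => ∏ c ∈ w j, (ω₀ c + ∑ a ∈ u i, ω a c)).det ≠ 0 := by
  classical
  set e : Fin r → ℕ := fun i => ∑ a ∈ u i, ((a : ℕ) + 1) with he
  set x : Fin r → ℂ := fun j => (2 : ℂ) ^ (∑ c ∈ w j, 2 ^ (c : ℕ)) with hx
  refine ⟨fun _ => 1, fun a c => (2 : ℂ) ^ (((a : ℕ) + 1) * 2 ^ (c : ℕ)) - 1, ?_⟩
  -- shape of the rows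
  have hrow : ∀ i, u i = ∅ ∨ ∃ a, u i = {a} := fun i => by
    rcases Nat.le_one_iff_eq_zero_or_eq_one.mp (hsmall i) with h0 | h1
    · exact Or.inl (Finset.card_eq_zero.mp h0)
    · exact Or.inr (Finset.card_eq_one.mp h1)
  -- the entry identity `A[i,j] = x_j ^ e_i`
  have hentry : ∀ i j, ∏ c ∈ w j, ((1 : ℂ) + ∑ a ∈ u i, ((2 : ℂ) ^ (((a : ℕ) + 1) * 2 ^ (c : ℕ)) - 1)) =
      x j ^ e i := by
    intro i j
    rcases hrow i with h0 | ⟨a, ha⟩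
    · simp [he, hx, h0]
    · have hei : e i = (a : ℕ) + 1 := by simp [he, ha]
      rw [hei, hx, ha]
      simp only [Finset.sum_singleton, add_sub_cancel]
      rw [← pow_mul, Finset.sum_mul, Finset.prod_pow_eq_pow_sum]
      congr 1
      exact Finset.sum_congr rfl fun c _ => by ring
  -- `e` is a bijection onto `Fin (h + 1)`
  have he_lt : ∀ i, e i < h + 1 := fun i => by
    rcases hrow i with h0 | ⟨a, ha⟩
    · simp [he, h0]
    · simp only [he, ha, Finset.sum_singleton]; omega
  have he_val : ∀ i a, u i = {a} → e i = (a : ℕ) + 1 := fun i a ha => by simp [he, ha]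
  have he_zero : ∀ i, u i = ∅ → e i = 0 := fun i h0 => by simp [he, h0]
  set E : Fin r → Fin (h + 1) := fun i => ⟨e i, he_lt i⟩ with hE
  have hEinj : Function.Injective E := by
    intro i i' hii'
    have hv : e i = e i' := by simpa [hE] using congrArg Fin.val hii'
    apply hu
    rcases hrow i with h0 | ⟨a, ha⟩ <;> rcases hrow i' with h0' | ⟨a', ha'⟩
    · rw [h0, h0']
    · rw [he_zero i h0, he_val i' a' ha'] at hv; omega
    · rw [he_val i a ha, he_zero i' h0'] at hv; omega
    · rw [he_val i a ha, he_val i' a' ha'] at hv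
      rw [ha, ha', Fin.ext (by omega : (a : ℕ) = a')]
  have hEsurj : Function.Surjective E := by
    intro k
    by_cases hk : (k : ℕ) = 0
    · obtain ⟨i, hi⟩ := hall ∅ (by simp)
      exact ⟨i, Fin.ext (by rw [hk]; exact he_zero i hi)⟩
    · have hk' : (k : ℕ) - 1 < h := by have := k.2; omega
      obtain ⟨i, hi⟩ := hall {⟨(k : ℕ) - 1, hk'⟩} (by simp)
      refine ⟨i, Fin.ext ?_⟩
      rw [show (E i : ℕ) = e i from rfl, he_val i _ hi]
      simp only
      omega
  set Eq : Fin r ≃ Fin (h + 1) := Equiv.ofBijective E ⟨hEinj, hEsurj⟩ with hEq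
  -- the matrix is a reindexed transposed Vandermonde matrix
  have hM : (Matrix.of fun i j : Fin r =>
      ∏ c ∈ w j, ((1 : ℂ) + ∑ a ∈ u i, ((2 : ℂ) ^ (((a : ℕ) + 1) * 2 ^ (c : ℕ)) - 1))) =
      ((Matrix.vandermonde (x ∘ Eq.symm)).transpose).submatrix Eq Eq := by
    ext i j
    rw [Matrix.of_apply, hentry, Matrix.submatrix_apply, Matrix.transpose_apply,
      Matrix.vandermonde_apply, Function.comp_apply, Equiv.symm_apply_apply]
    rfl
  -- distinct nodes
  have hx_inj : Function.Injective x := by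
    intro j j' hjj'
    apply hw
    have h2 : ((2 : ℕ) : ℂ) = 2 := by norm_num
    have hnat : (2 : ℕ) ^ (∑ c ∈ w j, 2 ^ (c : ℕ)) = 2 ^ (∑ c ∈ w j', 2 ^ (c : ℕ)) := by
      have := hjj'
      simp only [hx] at this
      exact_mod_cast this
    exact Literature.Computability.AlgebraicComplexity.doublingExp_injective h
      (Nat.pow_right_injective le_rfl hnat)
  rw [hM, Matrix.det_submatrix_equiv_self, Matrix.det_transpose]
  exact Matrix.det_vandermonde_ne_zero_iff.mpr (hx_inj.comp Eq.symm.injective)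

/-- **Rows `{∅} ∪ singletons` × ANY `h+1` columns** are hit in `SmallCircuits ℂ (h+h) 5` (`h ≥ 2`). -/
theorem partitionMinor_hit_ballRows_one (h : ℕ) (hh : 2 ≤ h) {r : ℕ} (u w : Fin r → Finset (Fin h))
    (hu : Function.Injective u) (hw : Function.Injective w)
    (hsmall : ∀ i, (u i).card ≤ 1) (hall : ∀ S : Finset (Fin h), S.card ≤ 1 → ∃ i, u i = S) :
    ∃ f ∈ SmallCircuits ℂ (h + h) 5,
      (Matrix.of fun i j : Fin r => MvPolynomial.coeff
        (∑ a ∈ u i, Finsupp.single (Fin.castAdd h a) 1 +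
          ∑ c ∈ w j, Finsupp.single (Fin.natAdd h c) 1) f).det ≠ 0 :=
  partitionMinor_hit_ballRows_of_universal h 1 hh (ballRowsUniversal_one h) u w hu hw hsmall hall

/-- **ANY `h+1` rows × columns `{∅} ∪ singletons`** are hit in `SmallCircuits ℂ (h+h) 5` (`h ≥ 2`) — in
particular the transposes of the capacity layouts (rows = a cube `2^T` padded, columns `∅` + singletons). -/
theorem partitionMinor_hit_ballColumns_one (h : ℕ) (hh : 2 ≤ h) {r : ℕ} (u w : Fin r → Finset (Fin h))
    (hu : Function.Injective u) (hw : Function.Injective w)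
    (hsmall : ∀ j, (w j).card ≤ 1) (hall : ∀ S : Finset (Fin h), S.card ≤ 1 → ∃ j, w j = S) :
    ∃ f ∈ SmallCircuits ℂ (h + h) 5,
      (Matrix.of fun i j : Fin r => MvPolynomial.coeff
        (∑ a ∈ u i, Finsupp.single (Fin.castAdd h a) 1 +
          ∑ c ∈ w j, Finsupp.single (Fin.natAdd h c) 1) f).det ≠ 0 :=
  partitionMinor_hit_ballColumns_of_universal h 1 hh (ballRowsUniversal_one h) u w hu hw hsmall hall

end

end Summit.ValiantsHypothesis.ValiantsHypothesis.Theorems.BarrierLever.AdditiveDoor
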